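import Summits.Ventures.CertifiedArithmetic.LowPrec.GemmEnvelopeRows

/-!
# GEMM-level envelopes, part (p): rows P3, P6, P7 decided UNDER THE PIPELINES (pub-lowprec gemm gen 22, LXX-p)

HONEST FRAMING: certified error envelopes and provably optimal rounding/accumulation schemes for
low-precision formats under stated cost models; every table by two implementations; no hardware or
vendor claims.

Companion of part (o).  The decision-table rows compare quantisers under exact accumulation; here rows
P3 («MX-E4M3-ceil ≼ per-vector INT8»), P6 («MX-E4M3-ceil ≼ per-vector E5M2, not conversely») and P7
(«ceil scale ≼ OCP floor scale, not conversely») are restated with the accumulation model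
`|acc - ΣΣ q̂a q̂b| ≤ γ·ΣΣ|q̂a q̂b|`, `γ ≤ 1/2048` (Binary32, two-level with `k + B ≤ 8193` or any order with
`K ≤ 8193`) and the output model `|c - acc| ≤ δ|acc|`, `δ ≤ 1/257` (BFloat16 or finer) switched on.
* `mxCeil_le_pipelines` (the common tie side): MX-E4M3-ceil on `C(κ)`, `κ ≤ 14336`: every pipeline output
  has `|c - S| ≤ C_Π·L`, `C_Π = 35/289 + (1/2048)(324/289) + (1/257)(324/289)(1 + 1/2048) ≈ 0.126019`.
* `pipeline_witness_up` / `pipeline_witness_down`: the realisation-free lower bound on the output error of a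
  constant-cell witness whose quantised product is `P` per cell against the exact `S` per cell:
  `c ≥ (2047/2048)(256/257)·N·P` (rounding up) resp. `c ≤ (2049/2048)(258/257)·N·P` (rounding down).
* `row_P3_int8_fails_pipelines` (`κ ≥ 254/15`): per-vector INT8, all entries `15/2` with numerator `127`
  (`7.5 ↦ 8`): output error `> C_Π·L` for every realisation (`(C_Π + 1)·56.25 < 64·(2047/2048)(256/257)`).
* `row_P6_vecE5M2_fails_pipelines` (`κ ≥ 2`): per-vector E5M2, all entries `38000` with numerator `57344`
  (`38000 ↦ 40960`): output error `> C_Π·L` for every realisation.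
* `row_P7_floor_fails_pipelines` (`κ ≥ 1`): OCP floor scale, all entries `500` (clipped to `448`): output
  error `> C_Π·L` for every realisation (the error is a shortfall: `c ≤ (2049/2048)(258/257)·Q`).
Hence on the stated `κ`-ranges (intersected with `κ ≤ 14336`) rows P3, P6, P7 hold at the GEMM OUTPUT,
Binary32 accumulation and BFloat16 output included: `sup_{C(κ)} F1_full(MXC) ≤ C_Π < F1_full(witness)`
(realised margins `≥ 6·10⁻³`; cert GEMM-ENVELOPES-ROBUST.json rows P3_int8, P6_vec5, P7_floor).
[cite: RouhaniEtAl2023MX, §5.1, §6.3]; [cite: Higham2002ASNA, §3.1]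
-/

namespace Summit.Ventures.CertifiedArithmetic.LowPrec.GemmEnvelope

open Finset
open Literature.ComputerArithmetic.FloatingPoint
open Literature.ComputerArithmetic.FloatingPoint.Format
open Literature.ComputerArithmetic.FloatingPoint.MiniFloat
open Literature.ComputerArithmetic.FloatingPoint.MXBlock
open Summit.Ventures.CertifiedArithmetic.LowPrec.SR

/-- THE COMMON TIE SIDE UNDER THE PIPELINES: MX-E4M3 with the ceil scale on `C(κ)`, `κ ≤ 14336`, any
accumulation with `γ ≤ 1/2048` and output with `δ ≤ 1/257`: `|c - S| ≤ C_Π · L`. [cite: Higham2002ASNA, §3.1] -/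
theorem mxCeil_le_pipelines {B k : ℕ} (a b qa qb : Fin B → Fin k → ℚ) {Aa Ab κ γ δ acc c : ℚ}
    (hγ0 : 0 ≤ γ) (hγ : γ ≤ 1 / 2048) (hδ0 : 0 ≤ δ) (hδ : δ ≤ 1 / 257) (hκ : κ ≤ 14336)
    (ha : ∀ j i, |a j i| ≤ Aa ∧ (a j i = 0 ∨ Aa ≤ κ * |a j i|))
    (hb : ∀ j i, |b j i| ≤ Ab ∧ (b j i = 0 ∨ Ab ≤ κ * |b j i|))
    (hqa : ∀ j i, qa j i = ceilScale E4M3 (a j) * (roundNE E4M3 (a j i / ceilScale E4M3 (a j))).toRat)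
    (hqb : ∀ j i, qb j i = ceilScale E4M3 (b j) * (roundNE E4M3 (b j i / ceilScale E4M3 (b j))).toRat)
    (hacc : |acc - ∑ j, ∑ i, qa j i * qb j i| ≤ γ * ∑ j, ∑ i, |qa j i * qb j i|)
    (hc : |c - acc| ≤ δ * |acc|) :
    |c - ∑ j, ∑ i, a j i * b j i|
      ≤ (35 / 289 + 1 / 2048 * (324 / 289) + 1 / 257 * (324 / 289) * (1 + 1 / 2048))
        * ∑ j, ∑ i, |a j i * b j i| := by
  have hca : ∀ j i, a j i = 0 ∨ blockMax (a j) ≤ κ * |a j i| := fun j i =>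
    (ha j i).2.imp_right fun h => le_trans
      (blockMax_le_of_forall_le (le_trans (abs_nonneg _) (ha j i).1) fun i' => (ha j i').1) h
  have hcb : ∀ j i, b j i = 0 ∨ blockMax (b j) ≤ κ * |b j i| := fun j i =>
    (hb j i).2.imp_right fun h => le_trans
      (blockMax_le_of_forall_le (le_trans (abs_nonneg _) (hb j i).1) fun i' => (hb j i').1) h
  have h := gemm_mxCeil_envelope_E4M3 a b qa qb hγ0 hδ0 hκ hca hcb hqa hqb hacc hc
  have hL : 0 ≤ ∑ j, ∑ i, |a j i * b j i| := sum_nonneg fun j _ => sum_nonneg fun i _ => abs_nonneg _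
  have hcoef : 35 / 289 + γ * (324 / 289) + δ * (324 / 289) * (1 + γ)
      ≤ 35 / 289 + 1 / 2048 * (324 / 289) + 1 / 257 * (324 / 289) * (1 + 1 / 2048) := by
    nlinarith [mul_le_mul hδ (by linarith : 1 + γ ≤ 1 + 1 / 2048) (by linarith) (by norm_num : (0:ℚ) ≤ 1 / 257)]
  exact le_trans h (mul_le_mul_of_nonneg_right hcoef hL)

/-- Realisation-free lower bound, rounding-UP witnesses: `N` cells with quantised product `P > 0` and exact
product `S > 0` per cell; if `(C + 1)·S < (2047/2048)(256/257)·P` then the output error exceeds `C·L`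
whatever the accumulation (`γ ≤ 1/2048`) and output (`δ ≤ 1/257`) realisations. [cite: Higham2002ASNA, §3.1] -/
theorem pipeline_witness_up {N P S C γ δ acc c : ℚ} (hN : 0 < N) (hP : 0 < P) (hS : 0 < S)
    (hγ : γ ≤ 1 / 2048) (hδ : δ ≤ 1 / 257)
    (hacc : |acc - N * P| ≤ γ * (N * |P|)) (hc : |c - acc| ≤ δ * |acc|)
    (hnum : (C + 1) * S < P * (2047 / 2048) * (256 / 257)) :
    C * (N * |S|) < |c - N * S| := by
  rw [abs_of_pos hP] at hacc
  rw [abs_of_pos hS]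
  have hQpos : 0 < N * P := mul_pos hN hP
  have hacc' : N * P - γ * (N * P) ≤ acc := by have := (abs_le.mp hacc).1; linarith
  have hγQ : γ * (N * P) ≤ 1 / 2048 * (N * P) := mul_le_mul_of_nonneg_right hγ hQpos.le
  have haccpos : 0 < acc := by linarith
  have hc' : acc - δ * acc ≤ c := by
    have := (abs_le.mp hc).1; rw [abs_of_pos haccpos] at this; linarith
  have hδacc : δ * acc ≤ 1 / 257 * acc := mul_le_mul_of_nonneg_right hδ haccpos.le
  have hclow : N * P * (2047 / 2048) * (256 / 257) ≤ c := by linarith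
  have hkey := mul_lt_mul_of_pos_left hnum hN
  have hgoal : C * (N * S) < c - N * S := by linarith
  exact lt_of_lt_of_le hgoal (le_abs_self _)

/-- Realisation-free lower bound, rounding-DOWN witnesses: if `(2049/2048)(258/257)·P + C·S < S` then the
output falls short of `S` by more than `C·L` for every realisation. [cite: Higham2002ASNA, §3.1] -/
theorem pipeline_witness_down {N P S C γ δ acc c : ℚ} (hN : 0 < N) (hP : 0 < P) (hS : 0 < S)
    (hγ : γ ≤ 1 / 2048) (hδ : δ ≤ 1 / 257)
    (hacc : |acc - N * P| ≤ γ * (N * |P|)) (hc : |c - acc| ≤ δ * |acc|)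
    (hnum : P * (2049 / 2048) * (258 / 257) + C * S < S) :
    C * (N * |S|) < |c - N * S| := by
  rw [abs_of_pos hP] at hacc
  rw [abs_of_pos hS]
  have hQpos : 0 < N * P := mul_pos hN hP
  have hacc1 : N * P - γ * (N * P) ≤ acc := by have := (abs_le.mp hacc).1; linarith
  have hacc2 : acc ≤ N * P + γ * (N * P) := by have := (abs_le.mp hacc).2; linarith
  have hγQ : γ * (N * P) ≤ 1 / 2048 * (N * P) := mul_le_mul_of_nonneg_right hγ hQpos.le
  have haccpos : 0 < acc := by linarith
  have hc' : c ≤ acc + δ * acc := by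
    have := (abs_le.mp hc).2; rw [abs_of_pos haccpos] at this; linarith
  have hδacc : δ * acc ≤ 1 / 257 * acc := mul_le_mul_of_nonneg_right hδ haccpos.le
  have hcup : c ≤ N * P * (2049 / 2048) * (258 / 257) := by nlinarith
  have hkey := mul_lt_mul_of_pos_left hnum hN
  have hgoal : C * (N * S) < N * S - c := by linarith
  rw [abs_sub_comm]
  exact lt_of_lt_of_le hgoal (le_abs_self _)

/-- **ROW P3 UNDER THE PIPELINES** (separating side): for `κ ≥ 254/15` a per-vector-INT8 input in `C(κ)`
(all entries `15/2`, numerator `127`, `7.5 ↦ 8`) whose output error exceeds `C_Π·L` for EVERY accumulation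
(`γ ≤ 1/2048`) and output (`δ ≤ 1/257`) realisation; with `mxCeil_le_pipelines` this decides row P3 at the
GEMM output for `254/15 ≤ κ ≤ 14336`. [cite: RouhaniEtAl2023MX, §5.1] -/
theorem row_P3_int8_fails_pipelines {B k : ℕ} (hB : 0 < B) (hk : 0 < k) {κ : ℚ} (hκ : 254 / 15 ≤ κ) :
    ∃ (a b : Fin B → Fin k → ℚ) (Aa Ab : ℚ),
      (∀ j i, |a j i| ≤ Aa ∧ (a j i = 0 ∨ Aa ≤ κ * |a j i|)) ∧
      (∀ j i, |b j i| ≤ Ab ∧ (b j i = 0 ∨ Ab ≤ κ * |b j i|)) ∧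
      ∀ (γ δ acc c : ℚ), γ ≤ 1 / 2048 → δ ≤ 1 / 257 →
        |acc - ∑ j, ∑ i, (Aa / 127 * (round (a j i / (Aa / 127)) : ℚ)) *
            (Ab / 127 * (round (b j i / (Ab / 127)) : ℚ))|
          ≤ γ * ∑ j, ∑ i, |(Aa / 127 * (round (a j i / (Aa / 127)) : ℚ)) *
            (Ab / 127 * (round (b j i / (Ab / 127)) : ℚ))| →
        |c - acc| ≤ δ * |acc| →
        (35 / 289 + 1 / 2048 * (324 / 289) + 1 / 257 * (324 / 289) * (1 + 1 / 2048))
            * ∑ j, ∑ i, |a j i * b j i| < |c - ∑ j, ∑ i, a j i * b j i| := by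
  have hx0 : (0 : ℚ) < 15 / 2 := by norm_num
  have hmem : ∀ (j : Fin B) (i : Fin k), |(fun (_ : Fin B) (_ : Fin k) => (15 : ℚ) / 2) j i| ≤ 127 ∧
      ((fun (_ : Fin B) (_ : Fin k) => (15 : ℚ) / 2) j i = 0 ∨
        127 ≤ κ * |(fun (_ : Fin B) (_ : Fin k) => (15 : ℚ) / 2) j i|) := fun _ _ => by
    refine ⟨by rw [abs_of_pos hx0]; norm_num, Or.inr ?_⟩
    rw [abs_of_pos hx0]; linarith
  have h8 : (127 : ℚ) / 127 * (round ((15 : ℚ) / 2 / (127 / 127)) : ℚ) = 8 := by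
    have hr : round ((15 : ℚ) / 2 / (127 / 127)) = 8 := by
      rw [show (15 : ℚ) / 2 / (127 / 127) = 15 / 2 by norm_num, round_eq]; norm_num
    rw [hr]; norm_num
  refine ⟨fun _ _ => 15 / 2, fun _ _ => 15 / 2, 127, 127, hmem, hmem, ?_⟩
  intro γ δ acc c hγ hδ hacc hc
  simp only [h8, sum_const, card_univ, Fintype.card_fin, nsmul_eq_mul] at hacc ⊢
  have hN : (0 : ℚ) < (B : ℚ) * (k : ℚ) := by
    have : (0 : ℚ) < (B : ℚ) := by exact_mod_cast hB
    have : (0 : ℚ) < (k : ℚ) := by exact_mod_cast hk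
    positivity
  have e1 : ((B : ℚ) * ((k : ℚ) * (8 * 8)) : ℚ) = (B : ℚ) * (k : ℚ) * (8 * 8) := by ring
  have e2 : ((B : ℚ) * ((k : ℚ) * |(8 : ℚ) * 8|) : ℚ) = (B : ℚ) * (k : ℚ) * |(8 : ℚ) * 8| := by ring
  have e3 : ((B : ℚ) * ((k : ℚ) * ((15 : ℚ) / 2 * (15 / 2))) : ℚ) = (B : ℚ) * (k : ℚ) * (15 / 2 * (15 / 2)) := by
    ring
  have e4 : ((B : ℚ) * ((k : ℚ) * |(15 : ℚ) / 2 * (15 / 2)|) : ℚ) = (B : ℚ) * (k : ℚ) * |(15 : ℚ) / 2 * (15 / 2)| := by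
    ring
  rw [e1, e2] at hacc
  rw [e3, e4]
  exact pipeline_witness_up hN (by norm_num) (by norm_num) hγ hδ hacc hc (by norm_num)

/-- **ROW P6 UNDER THE PIPELINES** (separating side): for `κ ≥ 2` a per-vector-E5M2 input in `C(κ)` (all
entries `38000`, numerator `57344 = E5M2.maxRat`, `38000 ↦ 40960`) whose output error exceeds `C_Π·L` for
EVERY realisation; with `mxCeil_le_pipelines` this decides row P6 at the GEMM output for `2 ≤ κ ≤ 14336`.
[cite: RouhaniEtAl2023MX, §6.3] -/
theorem row_P6_vecE5M2_fails_pipelines {B k : ℕ} (hB : 0 < B) (hk : 0 < k) {κ : ℚ} (hκ : 2 ≤ κ) :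
    ∃ (a b : Fin B → Fin k → ℚ) (Aa Ab : ℚ),
      (∀ j i, |a j i| ≤ Aa ∧ (a j i = 0 ∨ Aa ≤ κ * |a j i|)) ∧
      (∀ j i, |b j i| ≤ Ab ∧ (b j i = 0 ∨ Ab ≤ κ * |b j i|)) ∧
      ∀ (γ δ acc c : ℚ), γ ≤ 1 / 2048 → δ ≤ 1 / 257 →
        |acc - ∑ j, ∑ i, (Aa / E5M2.maxRat * (roundNE E5M2 (a j i / (Aa / E5M2.maxRat))).toRat) *
            (Ab / E5M2.maxRat * (roundNE E5M2 (b j i / (Ab / E5M2.maxRat))).toRat)|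
          ≤ γ * ∑ j, ∑ i, |(Aa / E5M2.maxRat * (roundNE E5M2 (a j i / (Aa / E5M2.maxRat))).toRat) *
            (Ab / E5M2.maxRat * (roundNE E5M2 (b j i / (Ab / E5M2.maxRat))).toRat)| →
        |c - acc| ≤ δ * |acc| →
        (35 / 289 + 1 / 2048 * (324 / 289) + 1 / 257 * (324 / 289) * (1 + 1 / 2048))
            * ∑ j, ∑ i, |a j i * b j i| < |c - ∑ j, ∑ i, a j i * b j i| := by
  have hM5 : E5M2.maxRat = 57344 := witness_values.2.2.2.2.2.2.2.2.1
  have hx0 : (0 : ℚ) < 38000 := by norm_num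
  have hmem : ∀ (j : Fin B) (i : Fin k), |(fun (_ : Fin B) (_ : Fin k) => (38000 : ℚ)) j i| ≤ 57344 ∧
      ((fun (_ : Fin B) (_ : Fin k) => (38000 : ℚ)) j i = 0 ∨
        57344 ≤ κ * |(fun (_ : Fin B) (_ : Fin k) => (38000 : ℚ)) j i|) := fun _ _ => by
    refine ⟨by rw [abs_of_pos hx0]; norm_num, Or.inr ?_⟩
    rw [abs_of_pos hx0]; linarith
  have hq : (57344 : ℚ) / E5M2.maxRat * (roundNE E5M2 (38000 / (57344 / E5M2.maxRat))).toRat = 40960 := by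
    rw [hM5, div_self (by norm_num : (57344 : ℚ) ≠ 0), div_one, witness_values.2.2.2.2.2.2.1, one_mul]
  refine ⟨fun _ _ => 38000, fun _ _ => 38000, 57344, 57344, hmem, hmem, ?_⟩
  intro γ δ acc c hγ hδ hacc hc
  simp only [hq, sum_const, card_univ, Fintype.card_fin, nsmul_eq_mul] at hacc ⊢
  have hN : (0 : ℚ) < (B : ℚ) * (k : ℚ) := by
    have : (0 : ℚ) < (B : ℚ) := by exact_mod_cast hB
    have : (0 : ℚ) < (k : ℚ) := by exact_mod_cast hk
    positivity
  have e1 : ((B : ℚ) * ((k : ℚ) * (40960 * 40960)) : ℚ) = (B : ℚ) * (k : ℚ) * (40960 * 40960) := by ring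
  have e2 : ((B : ℚ) * ((k : ℚ) * |(40960 : ℚ) * 40960|) : ℚ) = (B : ℚ) * (k : ℚ) * |(40960 : ℚ) * 40960| := by
    ring
  have e3 : ((B : ℚ) * ((k : ℚ) * (38000 * 38000)) : ℚ) = (B : ℚ) * (k : ℚ) * (38000 * 38000) := by ring
  have e4 : ((B : ℚ) * ((k : ℚ) * |(38000 : ℚ) * 38000|) : ℚ) = (B : ℚ) * (k : ℚ) * |(38000 : ℚ) * 38000| := by
    ring
  rw [e1, e2] at hacc
  rw [e3, e4]
  exact pipeline_witness_up hN (by norm_num) (by norm_num) hγ hδ hacc hc (by norm_num)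

/-- **ROW P7 UNDER THE PIPELINES** (separating side): for `κ ≥ 1` an input in `C(κ)` (all entries `500`,
clipped to `448` under the OCP floor scale) whose floor-scale output error exceeds `C_Π·L` for EVERY
realisation; with `mxCeil_le_pipelines` this decides row P7 at the GEMM output for `1 ≤ κ ≤ 14336`.
[cite: RouhaniEtAl2023MX, §6.3] -/
theorem row_P7_floor_fails_pipelines {B k : ℕ} (hB : 0 < B) (hk : 0 < k) {κ : ℚ} (hκ : 1 ≤ κ) :
    ∃ (a b : Fin B → Fin k → ℚ) (Aa Ab : ℚ),
      (∀ j i, |a j i| ≤ Aa ∧ (a j i = 0 ∨ Aa ≤ κ * |a j i|)) ∧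
      (∀ j i, |b j i| ≤ Ab ∧ (b j i = 0 ∨ Ab ≤ κ * |b j i|)) ∧
      ∀ (γ δ acc c : ℚ), γ ≤ 1 / 2048 → δ ≤ 1 / 257 →
        |acc - ∑ j, ∑ i, (scaleRat E4M3 (a j) * (roundNE E4M3 (a j i / scaleRat E4M3 (a j))).toRat) *
            (scaleRat E4M3 (b j) * (roundNE E4M3 (b j i / scaleRat E4M3 (b j))).toRat)|
          ≤ γ * ∑ j, ∑ i, |(scaleRat E4M3 (a j) * (roundNE E4M3 (a j i / scaleRat E4M3 (a j))).toRat) *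
            (scaleRat E4M3 (b j) * (roundNE E4M3 (b j i / scaleRat E4M3 (b j))).toRat)| →
        |c - acc| ≤ δ * |acc| →
        (35 / 289 + 1 / 2048 * (324 / 289) + 1 / 257 * (324 / 289) * (1 + 1 / 2048))
            * ∑ j, ∑ i, |a j i * b j i| < |c - ∑ j, ∑ i, a j i * b j i| := by
  obtain ⟨n, rfl⟩ : ∃ n, k = n + 1 := ⟨k - 1, by omega⟩
  have hx0 : (0 : ℚ) < 500 := by norm_num
  have hmem : ∀ (j : Fin B) (i : Fin (n + 1)), |(fun (_ : Fin B) (_ : Fin (n + 1)) => (500 : ℚ)) j i| ≤ 500 ∧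
      ((fun (_ : Fin B) (_ : Fin (n + 1)) => (500 : ℚ)) j i = 0 ∨
        500 ≤ κ * |(fun (_ : Fin B) (_ : Fin (n + 1)) => (500 : ℚ)) j i|) := fun _ _ => by
    refine ⟨by rw [abs_of_pos hx0], Or.inr ?_⟩
    rw [abs_of_pos hx0]; linarith
  have h448 : scaleRat E4M3 (fun _ : Fin (n + 1) => (500 : ℚ)) *
      (roundNE E4M3 (500 / scaleRat E4M3 (fun _ : Fin (n + 1) => (500 : ℚ)))).toRat = 448 := by
    have h := (mx_const_500 n (0 : Fin (n + 1))).2; beta_reduce at h; exact h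
  refine ⟨fun _ _ => 500, fun _ _ => 500, 500, 500, hmem, hmem, ?_⟩
  intro γ δ acc c hγ hδ hacc hc
  simp only [h448, sum_const, card_univ, Fintype.card_fin, nsmul_eq_mul] at hacc ⊢
  have hN : (0 : ℚ) < (B : ℚ) * ((n + 1 : ℕ) : ℚ) := by
    have : (0 : ℚ) < (B : ℚ) := by exact_mod_cast hB
    positivity
  have e1 : ((B : ℚ) * (((n + 1 : ℕ) : ℚ) * (448 * 448)) : ℚ) = (B : ℚ) * ((n + 1 : ℕ) : ℚ) * (448 * 448) := by
    ring
  have e2 : ((B : ℚ) * (((n + 1 : ℕ) : ℚ) * |(448 : ℚ) * 448|) : ℚ)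
      = (B : ℚ) * ((n + 1 : ℕ) : ℚ) * |(448 : ℚ) * 448| := by ring
  have e3 : ((B : ℚ) * (((n + 1 : ℕ) : ℚ) * (500 * 500)) : ℚ) = (B : ℚ) * ((n + 1 : ℕ) : ℚ) * (500 * 500) := by
    ring
  have e4 : ((B : ℚ) * (((n + 1 : ℕ) : ℚ) * |(500 : ℚ) * 500|) : ℚ)
      = (B : ℚ) * ((n + 1 : ℕ) : ℚ) * |(500 : ℚ) * 500| := by ring
  rw [e1, e2] at hacc
  rw [e3, e4]
  exact pipeline_witness_down hN (by norm_num) (by norm_num) hγ hδ hacc hc (by norm_num)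

end Summit.Ventures.CertifiedArithmetic.LowPrec.GemmEnvelope
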